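import Mathlib
import Literature.AlgebraicGeometry.Resolution.WeightedResolutionDatum
import Summits.ResolutionOfSingularities.ResolutionOfSingularities.Theses.WeightedInvariant
import Literature.AlgebraicGeometry.Resolution.LipmanProcedure

/-!
# Sketch — crux-ideate stmt-0572 (`DatumToEmbedded`), ideator 2, round 1

First-lemma signatures for the idea cards (they must elaborate; proofs are not required here).
-/

noncomputable section

open IsLocalRing MvPolynomial

namespace Summit.ResolutionOfSingularities.ResolutionOfSingularities.Cruxes.DatumToEmbedded.Ideator2

universe u

/-! ## Card A `graded-reflection-saturation` — first lemma

The p-INCLUSIVE pseudo-reflection lemma: a `ℤ/n`-GRADED regular local ring (the grading is the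
action of the diagonalisable group scheme `μ_n`, `p ∣ n` allowed — no root of unity, no `n ∈ Aˣ`)
whose maximal ideal is generated by ONE homogeneous element `z₀` of degree `1` together with
degree-`0` elements has a regular degree-`0` subring `A = B₀`, with `𝔪_A = (z₀ⁿ, z₁, …, z_d)`.
Compare the TAME lemma already in tree,
`Literature.AlgebraicGeometry.Resolution.isRegularLocalRing_of_fixed_pseudoReflection`
(automorphism `σ` of order `ℓ ∈ Aˣ`, `ζ` a primitive root): here the automorphism and `ζ` are
replaced by the projectors of an internal direct-sum decomposition, which exist for `μ_p` too. -/
def GradedPseudoReflection : Prop :=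
  ∀ (A B : Type u) [CommRing A] [CommRing B] [Algebra A B] [IsLocalRing A] [IsNoetherianRing A]
    [IsRegularLocalRing B] [Module.Finite A B],
    Function.Injective (algebraMap A B) →
    ∀ (n : ℕ) [NeZero n] (𝓑 : ZMod n → Submodule A B), DirectSum.IsInternal 𝓑 →
      (∀ i j, 𝓑 i * 𝓑 j ≤ 𝓑 (i + j)) → 𝓑 0 = 1 →
      (∀ b : B, ∃ a : A, b - algebraMap A B a ∈ maximalIdeal B) →
      ∀ (d : ℕ) (z₀ : B) (z : Fin d → A), z₀ ∈ 𝓑 1 →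
        Ideal.span (insert z₀ (Set.range fun j => algebraMap A B (z j))) = maximalIdeal B →
        ringKrullDim B = (d + 1 : ℕ) →
        IsRegularLocalRing A ∧ ∃ w₀ : A, algebraMap A B w₀ = z₀ ^ n ∧
          Ideal.span (insert w₀ (Set.range z)) = maximalIdeal A

/-! ## Card A — the terminal criterion in monoid form (diagonal Chevalley–Shephard–Todd)

For characters `χ : Fin c → Aₓ` of a finite abelian group (the conormal characters of a closed
orbit), the invariant monoid `Λ = {α ∈ ℕᶜ | Σ αⱼ χⱼ = 0}` of the diagonal `D(Aₓ)`-action on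
`k[[y₁, …, y_c]]` is the free monoid `⊕ⱼ ℕ · ord(χⱼ) eⱼ` — i.e. `k[[Λ]] = k[[yⱼ^{ord χⱼ}]]` is
regular — as soon as `⊕ⱼ ℤ/ord(χⱼ) → Aₓ` is injective (REFLECTION DATUM). Characteristic-free. -/
def ReflectionDatumFree : Prop :=
  ∀ (c : ℕ) (G : Type u) [AddCommGroup G] [Finite G] (χ : Fin c → G),
    (∀ α : Fin c → ℤ, ∑ j, α j • χ j = 0 → ∀ j, (addOrderOf (χ j) : ℤ) ∣ α j) →
    ∀ α : Fin c → ℕ, (∑ j, α j • χ j = 0 ↔ ∀ j, addOrderOf (χ j) ∣ α j)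

/-! ## Card A — root-frame move keeps the upstairs scheme regular (the stack-free root stack)

`R'' = R[z, λ, λ⁻¹]/(λ zⁿ − f)`: where `f` is a unit, `z` is a unit and `R'' ≅ R[z, z⁻¹]`; where
`f` is a regular parameter it is replaced by `z`. Ring-level first instance (`f` a unit). -/
def RootFrameUnit : Prop :=
  ∀ (R : Type u) [CommRing R] (f : Rˣ) (n : ℕ), 0 < n →
    Nonempty ((MvPolynomial (Fin 2) R ⧸ Ideal.span
      {(X 0 : MvPolynomial (Fin 2) R) * X 1 ^ n - C (f : R)}) ≃ₐ[R]
        Localization.Away ((X 0 : MvPolynomial (Fin 2) R) * X 1))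
  -- `X 0 = λ`, `X 1 = z`; both become units since `λ zⁿ = f` is a unit.

/-! ## Card B `torific-toroidal-quotient` — first lemma

The torific ideal of a character `m` (AKMW, Def. 3.1.2: the ideal generated by all
semi-invariant functions of character `m`) of a DIAGONAL action — weights `w : σ → M` on a
polynomial ring — is the MONOMIAL ideal spanned by the monomials of weight `m`; and torific
ideals are multiplicative. This is why the torific blow-up is a toric modification in the local
model. -/
def TorificIdealMonomial : Prop :=
  ∀ (σ M R : Type u) [AddCommMonoid M] [CommRing R] (w : σ → M) (m : M),
    Ideal.span {φ : MvPolynomial σ R | IsWeightedHomogeneous w φ m} =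
      Ideal.span ((fun d : σ →₀ ℕ => monomial d (1 : R)) '' {d | Finsupp.weight w d = m})

/-- Torific ideals are multiplicative: `I_m · I_{m'} ≤ I_{m+m'}` (immediate from
`IsWeightedHomogeneous.mul`). -/
theorem torific_mul (σ M R : Type u) [AddCommMonoid M] [CommRing R] (w : σ → M) (m m' : M) :
    Ideal.span {φ : MvPolynomial σ R | IsWeightedHomogeneous w φ m} *
        Ideal.span {φ : MvPolynomial σ R | IsWeightedHomogeneous w φ m'} ≤
      Ideal.span {φ : MvPolynomial σ R | IsWeightedHomogeneous w φ (m + m')} := by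
  rw [Ideal.span_mul_span']
  apply Ideal.span_mono
  rintro _ ⟨φ, hφ, ψ, hψ, rfl⟩
  exact hφ.mul hψ


/-! ## (NOT FILED) candidate `zariski-normalized-closure` — the Lean shape of the claim, kept as the record of a NEGATIVE finding

Kit jobs j017687 / j017722 (2026-08-16, exact fan arithmetic, `kit/toric_blowups.py`): Zariski's procedure resolves
all 59 three-dimensional and 209 of 214 four-dimensional cyclic quotient types tested, but DIVERGES on 1/6(1,2,3,5)
(≅ 1/6(1,3,4,5)) and 1/8(1,2,3,5) (≅ 1/8(1,2,5,7) ≅ 1/8(1,3,6,7)): from round 3 a pair of index-1 non-simplicial cones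
(5 rays / 7 rays) reproduces three copies of itself every round (singular maximal cones 7, 18, 54, 162, 486, 1458, 4374).
So `IntVar.ZariskiClosure` for the class of torus quotients of regular T-schemes is (empirically) FALSE from dimension 4 on;
the plumbing theorem below stays useful for ANY `iterate a canonical step` variant of S3.

Zariski's procedure in ARBITRARY dimension, on the tree's `lipmanStep` (blow up the reduced
singular locus, normalize; `Literature/…/LipmanProcedure.lean`, dimension-free for integral
schemes locally of finite type over a field), bundled so that it can be iterated, and the
statement "the procedure stops on the class `C`" together with its use. -/

open AlgebraicGeometry CategoryTheory Literature.AlgebraicGeometry.Resolution in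
/-- Integral schemes locally of finite type over `k`, bundled with their structure map. -/
structure IntVar (k : Type u) [Field k] where
  X : Scheme.{u}
  f : X ⟶ Spec (.of k)
  [isIntegral : IsIntegral X]
  [loft : LocallyOfFiniteType f]

namespace IntVar

open AlgebraicGeometry CategoryTheory Literature.AlgebraicGeometry.Resolution

variable {k : Type u} [Field k]

attribute [instance] IntVar.isIntegral IntVar.loft

/-- ONE ROUND of Zariski's procedure: `V ↦ (Bl_{Sing(V)_red} V)^ν` over `k`. -/
def step (V : IntVar k) : IntVar k where
  X := lipmanStep V.X V.f
  f := lipmanStep.π V.X V.f ≫ V.f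

/-- `ZariskiClosure C`: on the class `C` (meant: varieties over a perfect field with
diagonalisable quotient singularities of a regular scheme, i.e. torus quotients `X_m ⫽ T` of the
tower end) the procedure STOPS. The content of card C; combinatorial (`ZariskiFanGame`) modulo
the graded slice lemma. -/
def ZariskiClosure (C : IntVar k → Prop) : Prop :=
  ∀ V : IntVar k, C V → ∃ n : ℕ, Scheme.IsRegular (step^[n] V).X

/-- How the crux uses it (plumbing, provable from `Scheme.HasResolution.of_lipmanStep` by
induction on `n`): termination on `C` resolves every member of `C`. -/
def ZariskiClosureResolves (C : IntVar k → Prop) : Prop :=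
  ZariskiClosure C → ∀ V : IntVar k, C V → Scheme.HasResolution V.X

/-- The plumbing half, PROVED: if some Zariski iterate is regular then `V` has a resolution. -/
theorem hasResolution_of_isRegular_iterate (V : IntVar k) (n : ℕ)
    (h : Scheme.IsRegular (step^[n] V).X) : Scheme.HasResolution V.X := by
  induction n generalizing V with
  | zero => exact Scheme.IsRegular.hasResolution h
  | succ n ih =>
    rw [Function.iterate_succ_apply] at h
    exact Scheme.HasResolution.of_lipmanStep V.X V.f (ih (step V) h)

theorem zariskiClosureResolves (C : IntVar k → Prop) : ZariskiClosureResolves C :=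
  fun hZ V hV => by
    obtain ⟨n, hn⟩ := hZ V hV
    exact hasResolution_of_isRegular_iterate V n hn

end IntVar

/-! ## Sanity: the crux by name (what every line must conclude) -/
example : Prop := Summit.ResolutionOfSingularities.ResolutionOfSingularities.Theses.WeightedInvariant.DatumToEmbedded

end Summit.ResolutionOfSingularities.ResolutionOfSingularities.Cruxes.DatumToEmbedded.Ideator2

end
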